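import Literature.Probability.RandomPlanarGeometry.SAWUnfolding
import Literature.Probability.Percolation.LatticeSymmetry
import HarnessLib

/-!
# Two-sided unfolding: bridges of `ℤ²` are folded into rectangle walks, at most `e^{6√n}`-to-one
# (Duminil-Copin–Kozma–Yadin 2014, proof of Lemma 5, Step 1)

Topic `Literature/Probability/RandomPlanarGeometry` (continues `SAWUnfolding.lean`). Source:
H. Duminil-Copin, G. Kozma, A. Yadin, *Supercritical self-avoiding walks are space-filling*
(2014), §2, proof of Lemma 5, Step 1: a bridge is unfolded, by reflections of initial and final
pieces in lines parallel to the bridge direction, into a walk "contained in the rectangle with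
corners being its endpoints", and "the number of possible preimages under `f` is bounded by
`e^{c√n}`" (two decreasing sequences of widths).

We realise the two-sided unfolding with the one-sided Hammersley–Welsh unfolding `Zd.unfold`
(which puts the maximum of the first coordinate at the END, changing no other coordinate, at most
`e^{3√n}`-to-one by `Zd.card_le_exp_mul_card_image_unfold`) and two involutions of `saws d n`:
the time reversal `Zd.reverseWalk ω = (ω(n) - ω(n-i))ᵢ` (which exchanges "maximum at the end" and
"minimum at the start") and, on `ℤ²`, the transposition of the axes `Zd.transposeWalk`. For a
bridge `ω` of `ℤ²` (first coordinate in `(0, ω₀(n)]`), the walk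
`fold ω = unfold (reverseWalk (unfold (reverseWalk (transposeWalk ω))))` has its first
coordinate minimal at the start and maximal at the end and its second coordinate equal to the
bridge coordinate of `ω`: it is a rectangle walk (`fold_mem_rectangleFuns`), and
`ω ↦ (fold ω, the two codes)` is injective (`fold_codes_injOn`), whence
**`card_bridges_le_exp_mul_card_rectangleFuns : b_n ≤ e^{6√n} · #(rectangle walks)`**.
-/

noncomputable section

open Finset Function Literature.Probability.LatticeModels Literature.Probability.Percolation SimpleGraph
open Literature.Combinatorics.Enumerative

namespace Literature.Probability.RandomPlanarGeometry.SAW.Zd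

/-! ### Time reversal -/

section Reverse

variable {d : ℕ}

/-- **Time reversal** of an `n`-step walk from `0`, re-based at `0`: `i ↦ ω(n) - ω(n-i)` (frozen at
`ω(n)` from time `n` on). It exchanges first/last times and maxima/minima of every coordinate.
[folklore] -/
def reverseWalk (n : ℕ) (ω : ℕ → Site d) : ℕ → Site d :=
  fun i => ω n - ω (n - i)

/-- Values of the reversal. [folklore] -/
theorem reverseWalk_apply (n : ℕ) (ω : ℕ → Site d) (i : ℕ) : reverseWalk n ω i = ω n - ω (n - i) := rfl

/-- Time reversal is an involution on walks from `0`. [folklore] -/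
theorem reverseWalk_reverseWalk {n : ℕ} {ω : ℕ → Site d} (h0 : ω 0 = 0) (hend : ∀ i, n ≤ i → ω i = ω n) :
    reverseWalk n (reverseWalk n ω) = ω := by
  funext i
  simp only [reverseWalk, Nat.sub_self, h0, sub_zero]
  rcases le_or_gt i n with hi | hi
  · rw [Nat.sub_sub_self hi]; abel
  · rw [Nat.sub_eq_zero_of_le hi.le, Nat.sub_zero, hend i hi.le]; abel

/-- Time reversal maps `saws d n` to `saws d n`. [folklore] -/
theorem reverseWalk_mem_saws {n : ℕ} {ω : ℕ → Site d} (hω : ω ∈ saws d n) : reverseWalk n ω ∈ saws d n := by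
  obtain ⟨h0, hend, hadj, hinj⟩ := mem_saws.1 hω
  rw [mem_saws]
  refine ⟨by simp [reverseWalk], fun i hi => ?_, fun i hi => ?_, fun i hi j hj hij => ?_⟩
  · simp only [reverseWalk, Nat.sub_self, Nat.sub_eq_zero_of_le hi]
  · simp only [reverseWalk]
    have h := hadj (n - (i + 1)) (by omega)
    rw [show n - (i + 1) + 1 = n - i by omega] at h
    rw [zdGraph_adj_iff_sub] at h ⊢
    obtain ⟨k, hk⟩ := h
    refine ⟨k, ?_⟩
    rcases hk with hk | hk
    · left; rw [← hk]; abel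
    · right; rw [← hk]; abel
  · simp only [Set.mem_setOf_eq] at hi hj
    simp only [reverseWalk, sub_right_inj] at hij
    have := hinj (show n - i ∈ {i | i ≤ n} by simp) (show n - j ∈ {i | i ≤ n} by simp) hij
    omega

/-- Coordinates of the reversal. [folklore] -/
theorem reverseWalk_apply_coord (n : ℕ) (ω : ℕ → Site d) (i : ℕ) (j : Fin d) :
    reverseWalk n ω i j = ω n j - ω (n - i) j := by
  simp [reverseWalk]

end Reverse

/-! ### Walks with the first coordinate minimal at the start / maximal at the end -/

section MinMax

variable {d : ℕ} [NeZero d]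

/-- The reversal of a walk whose first coordinate is maximal at the end has its first coordinate
minimal at the start. [folklore] -/
theorem reverseWalk_min_at_start {n : ℕ} {ω : ℕ → Site d} (h : ∀ i ≤ n, ω i 0 ≤ ω n 0) :
    ∀ i ≤ n, reverseWalk n ω 0 0 ≤ reverseWalk n ω i 0 := by
  intro i _
  simp only [reverseWalk_apply_coord, Nat.sub_zero, sub_self]
  have := h (n - i) (Nat.sub_le n i)
  omega

/-- The reversal of a walk whose first coordinate is minimal at the start has its first
coordinate maximal at the end. [folklore] -/
theorem reverseWalk_max_at_end {n : ℕ} {ω : ℕ → Site d} (h0 : ω 0 = 0) (h : ∀ i ≤ n, ω 0 0 ≤ ω i 0) :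
    ∀ i ≤ n, reverseWalk n ω i 0 ≤ reverseWalk n ω n 0 := by
  intro i _
  simp only [reverseWalk_apply_coord, Nat.sub_self, h0]
  have := h (n - i) (Nat.sub_le n i)
  rw [h0] at this
  simp only [Pi.zero_apply] at this ⊢
  omega

/-- The first coordinate of `unfold ω` is maximal at the end (restated). [cite: MadrasSlade1993, §3.1 (proof of Proposition 3.1.5)] -/
theorem unfold_max_at_end {n : ℕ} {ω : ℕ → Site d} (hω : ω ∈ saws d n) :
    ∀ i ≤ n, unfold n ω i 0 ≤ unfold n ω n 0 := fun _ hi => apply_le_unfold_last hω hi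

end MinMax

/-! ### The transposition of the axes of `ℤ²` on walks -/

section Transpose

/-- Transposition of the two coordinates of a walk of `ℤ²`. [folklore] -/
def transposeWalk (ω : ℕ → Site 2) : ℕ → Site 2 := fun i => transposeIso (ω i)

/-- Coordinates of the transposed walk. [folklore] -/
@[simp] theorem transposeWalk_apply_zero (ω : ℕ → Site 2) (i : ℕ) : transposeWalk ω i 0 = ω i 1 := by
  simp [transposeWalk]

/-- Coordinates of the transposed walk. [folklore] -/
@[simp] theorem transposeWalk_apply_one (ω : ℕ → Site 2) (i : ℕ) : transposeWalk ω i 1 = ω i 0 := by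
  simp [transposeWalk]

/-- Transposition is an involution. [folklore] -/
@[simp] theorem transposeWalk_transposeWalk (ω : ℕ → Site 2) : transposeWalk (transposeWalk ω) = ω := by
  funext i
  simp only [transposeWalk]
  rw [← transposeIso_symm_apply, RelIso.symm_apply_apply]

/-- Transposition maps `saws 2 n` to `saws 2 n`. [folklore] -/
theorem transposeWalk_mem_saws {n : ℕ} {ω : ℕ → Site 2} (hω : ω ∈ saws 2 n) : transposeWalk ω ∈ saws 2 n := by
  obtain ⟨h0, hend, hadj, hinj⟩ := mem_saws.1 hω
  rw [mem_saws]
  refine ⟨by simp [transposeWalk, h0], fun i hi => by simp only [transposeWalk, hend i hi],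
    fun i hi => (transposeIso.map_rel_iff).2 (hadj i hi), fun i hi j hj hij => ?_⟩
  exact hinj hi hj (RelIso.injective transposeIso hij)

end Transpose

/-! ### The two-sided fold of a bridge of `ℤ²` into a rectangle walk -/

section Fold

/-- The `n`-step **rectangle walks** of `ℤ²` in the vertex-function model: self-avoiding walks
from `0` all of whose sites lie in the rectangle `[0, ω₀(n)] × [0, ω₁(n)]` spanned by the
endpoints. [cite: DuminilCopinKozmaYadin2014, Lemma 5 (proof, Step 1: definition of Σₙ)] -/
def rectangleFuns (n : ℕ) : Finset (ℕ → Site 2) :=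
  (saws 2 n).filter fun ω => ∀ i ≤ n, ∀ j, 0 ≤ ω i j ∧ ω i j ≤ ω n j

/-- Membership in `rectangleFuns`. [cite: DuminilCopinKozmaYadin2014, Lemma 5 (proof, Step 1)] -/
theorem mem_rectangleFuns {n : ℕ} {ω : ℕ → Site 2} :
    ω ∈ rectangleFuns n ↔ ω ∈ saws 2 n ∧ ∀ i ≤ n, ∀ j, 0 ≤ ω i j ∧ ω i j ≤ ω n j := by
  classical
  exact Finset.mem_filter

/-- Stage 1 of the fold: transpose (the bridge coordinate becomes the second one) and reverse.
[cite: DuminilCopinKozmaYadin2014, Lemma 5 (proof, Step 1)] -/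
def foldStage1 (n : ℕ) (ω : ℕ → Site 2) : ℕ → Site 2 := reverseWalk n (transposeWalk ω)

/-- Stage 2 of the fold: unfold (first-coordinate maximum to the end), reverse (it becomes a
minimum at the start). [cite: DuminilCopinKozmaYadin2014, Lemma 5 (proof, Step 1)] -/
def foldStage2 (n : ℕ) (ω : ℕ → Site 2) : ℕ → Site 2 := reverseWalk n (unfold n (foldStage1 n ω))

/-- **The two-sided fold**: unfold once more (first-coordinate maximum to the end, minimum kept at
the start). [cite: DuminilCopinKozmaYadin2014, Lemma 5 (proof, Step 1: the map f)] -/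
def fold (n : ℕ) (ω : ℕ → Site 2) : ℕ → Site 2 := unfold n (foldStage2 n ω)

variable {n : ℕ} {ω : ℕ → Site 2}

/-- Stage 1 is a self-avoiding walk. [folklore] -/
theorem foldStage1_mem_saws (hω : ω ∈ saws 2 n) : foldStage1 n ω ∈ saws 2 n :=
  reverseWalk_mem_saws (transposeWalk_mem_saws hω)

/-- Stage 2 is a self-avoiding walk. [folklore] -/
theorem foldStage2_mem_saws (hω : ω ∈ saws 2 n) : foldStage2 n ω ∈ saws 2 n :=
  reverseWalk_mem_saws (unfold_mem_saws (foldStage1_mem_saws hω))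

/-- The fold is a self-avoiding walk. [cite: DuminilCopinKozmaYadin2014, Lemma 5 (proof, Step 1)] -/
theorem fold_mem_saws (hω : ω ∈ saws 2 n) : fold n ω ∈ saws 2 n :=
  unfold_mem_saws (foldStage2_mem_saws hω)

/-- The second coordinate is untouched by the two unfoldings and restored by the two reversals:
`(fold ω)(i)₁ = ω(i)₀`. [cite: DuminilCopinKozmaYadin2014, Lemma 5 (proof, Step 1: reflections in vertical lines)] -/
theorem fold_apply_one (hω : ω ∈ saws 2 n) {i : ℕ} (hi : i ≤ n) : fold n ω i 1 = ω i 0 := by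
  obtain ⟨h0, hend, -, -⟩ := mem_saws.1 hω
  have h1 : (1 : Fin 2) ≠ 0 := by decide
  rw [fold, unfold, iterate_unfoldStep_apply_of_ne _ _ _ _ h1, foldStage2, reverseWalk_apply_coord,
    unfold, iterate_unfoldStep_apply_of_ne _ _ _ _ h1, iterate_unfoldStep_apply_of_ne _ _ _ _ h1,
    foldStage1, reverseWalk_apply_coord, reverseWalk_apply_coord, Nat.sub_self,
    Nat.sub_sub_self hi]
  simp [h0]

/-- In stage 2 the first coordinate is minimal at the start. [cite: DuminilCopinKozmaYadin2014, Lemma 5 (proof, Step 1)] -/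
theorem foldStage2_min_at_start (hω : ω ∈ saws 2 n) :
    ∀ i ≤ n, foldStage2 n ω 0 0 ≤ foldStage2 n ω i 0 :=
  reverseWalk_min_at_start (unfold_max_at_end (foldStage1_mem_saws hω))

/-- **The fold of a bridge is a rectangle walk**: first coordinate in `[0, end]` (minimum at the
start by stage 2 and `weakHalfSpace_iterate_unfoldStep`, maximum at the end by the last
unfolding), second coordinate the bridge coordinate of `ω`, in `[0, end]`.
[cite: DuminilCopinKozmaYadin2014, Lemma 5 (proof, Step 1: "f maps Λₙ on Σₙ")] -/
theorem fold_mem_rectangleFuns (hω : ω ∈ bridges 2 n) : fold n ω ∈ rectangleFuns n := by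
  obtain ⟨hs, hb⟩ := mem_bridges.1 hω
  have hs2 := foldStage2_mem_saws hs
  have hF := fold_mem_saws hs
  obtain ⟨hF0, -, -, -⟩ := mem_saws.1 hF
  obtain ⟨h0, -, -, -⟩ := mem_saws.1 hs
  rw [mem_rectangleFuns]
  refine ⟨hF, fun i hi j => ?_⟩
  fin_cases j
  · -- first coordinate
    have hmin := weakHalfSpace_iterate_unfoldStep (foldStage2_min_at_start hs) (n + 1) i hi
    have hmax := unfold_max_at_end hs2 i hi
    change 0 ≤ fold n ω i 0 ∧ fold n ω i 0 ≤ fold n ω n 0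
    have : fold n ω 0 0 = 0 := by rw [hF0]; rfl
    rw [← this]
    exact ⟨hmin, hmax⟩
  · -- second coordinate = bridge coordinate of `ω`
    change 0 ≤ fold n ω i 1 ∧ fold n ω i 1 ≤ fold n ω n 1
    rw [fold_apply_one hs hi, fold_apply_one hs le_rfl]
    have hn0 : 0 ≤ ω n 0 := by
      rcases Nat.eq_zero_or_pos n with rfl | hn
      · simp [h0]
      · have := (hb n hn le_rfl).1
        rw [h0] at this
        simpa using this.le
    rcases Nat.eq_zero_or_pos i with rfl | hpos
    · simp [h0, hn0]
    · have := hb i hpos hi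
      rw [h0] at this
      simp only [Pi.zero_apply] at this
      exact ⟨this.1.le, this.2⟩

/-- **`ω ↦ (fold ω, code of the second unfolding, code of the first unfolding)` is injective on
`saws 2 n`** (each unfolding is undone knowing its code, each reversal and the transposition is an
involution). [cite: DuminilCopinKozmaYadin2014, Lemma 5 (proof, Step 1: "the map which gives f(γ) and the widths … is one-to-one")] -/
theorem fold_codes_injOn (n : ℕ) :
    Set.InjOn (fun ω : ℕ → Site 2 => (fold n ω, code n (foldStage2 n ω), code n (foldStage1 n ω)))
      ↑(saws 2 n) := by
  intro ω hω ω' hω' h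
  simp only [Prod.mk.injEq] at h
  obtain ⟨hF, hC2, hC1⟩ := h
  have hω₁ : ω ∈ saws 2 n := hω
  have hω₂ : ω' ∈ saws 2 n := hω'
  -- undo the last unfolding
  have hS2 : foldStage2 n ω = foldStage2 n ω' :=
    unfold_code_injOn n (foldStage2_mem_saws hω₁) (foldStage2_mem_saws hω₂)
      (by simp only [Prod.mk.injEq]; exact ⟨hF, hC2⟩)
  -- undo the reversal
  have hU1 : unfold n (foldStage1 n ω) = unfold n (foldStage1 n ω') := by
    have e : ∀ ξ : ℕ → Site 2, ξ ∈ saws 2 n →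
        unfold n (foldStage1 n ξ) = reverseWalk n (foldStage2 n ξ) := fun ξ hξ => by
      obtain ⟨h0, hend, -, -⟩ := mem_saws.1 (unfold_mem_saws (foldStage1_mem_saws hξ))
      rw [foldStage2, reverseWalk_reverseWalk h0 hend]
    rw [e ω hω₁, e ω' hω₂, hS2]
  -- undo the first unfolding
  have hS1 : foldStage1 n ω = foldStage1 n ω' :=
    unfold_code_injOn n (foldStage1_mem_saws hω₁) (foldStage1_mem_saws hω₂)
      (by simp only [Prod.mk.injEq]; exact ⟨hU1, hC1⟩)
  -- undo the reversal and the transposition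
  have e : ∀ ξ : ℕ → Site 2, ξ ∈ saws 2 n → ξ = transposeWalk (reverseWalk n (foldStage1 n ξ)) :=
    fun ξ hξ => by
      obtain ⟨h0, hend, -, -⟩ := mem_saws.1 (transposeWalk_mem_saws hξ)
      rw [foldStage1, reverseWalk_reverseWalk h0 hend, transposeWalk_transposeWalk]
  rw [e ω hω₁, e ω' hω₂, hS1]

open Classical in
/-- **`bₙ ≤ e^{6√n} · #(rectangle walks of length n)`**: the bridges of `ℤ²` fold into rectangle
walks at most `e^{6√n}`-to-one (two codes, each among `≤ e^{3√n}` sets).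
[cite: DuminilCopinKozmaYadin2014, Lemma 5 (proof, Step 1: "the cardinality of Σₙ is thus larger than e^{-c√n} bₙ")] -/
theorem card_bridges_le_exp_mul_card_rectangleFuns (n : ℕ) :
    (bridgeCount 2 n : ℝ) ≤ Real.exp (6 * Real.sqrt n) * (rectangleFuns n).card := by
  have hsub : bridges 2 n ⊆ saws 2 n := fun ω hω => (mem_bridges.1 hω).1
  have hcard : (bridges 2 n).card ≤
      (rectangleFuns n ×ˢ (finsetsOfSumLE n ×ˢ finsetsOfSumLE n)).card := by
    refine Finset.card_le_card_of_injOn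
      (fun ω => (fold n ω, code n (foldStage2 n ω), code n (foldStage1 n ω))) (fun ω hω => ?_)
      fun ω hω ω' hω' h => fold_codes_injOn n (hsub hω) (hsub hω') h
    have hs := hsub hω
    exact Finset.mem_product.2 ⟨fold_mem_rectangleFuns hω, Finset.mem_product.2
      ⟨code_mem_finsetsOfSumLE (foldStage2_mem_saws hs), code_mem_finsetsOfSumLE (foldStage1_mem_saws hs)⟩⟩
  rw [Finset.card_product, Finset.card_product] at hcard
  have hP := card_finsetsOfSumLE_le_exp n
  have hP0 : (0 : ℝ) ≤ (finsetsOfSumLE n).card := Nat.cast_nonneg _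
  calc (bridgeCount 2 n : ℝ) = ((bridges 2 n).card : ℝ) := rfl
    _ ≤ (rectangleFuns n).card * ((finsetsOfSumLE n).card * (finsetsOfSumLE n).card : ℝ) := by
        exact_mod_cast hcard
    _ ≤ (rectangleFuns n).card * (Real.exp (3 * Real.sqrt n) * Real.exp (3 * Real.sqrt n)) := by
        refine mul_le_mul_of_nonneg_left (mul_le_mul hP hP hP0 (Real.exp_nonneg _)) (Nat.cast_nonneg _)
    _ = Real.exp (6 * Real.sqrt n) * (rectangleFuns n).card := by
        rw [← Real.exp_add]; ring_nf

end Fold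

end Literature.Probability.RandomPlanarGeometry.SAW.Zd
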